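import Literature.NumberTheory.Automorphic.Liu2021.AlbaneseBaseChangeProduct
import HarnessLib

/-!
# Liu 2021 §2.1: the Albanese datum of a split scheme — the COMPATIBILITY of the Albanese morphism with the pieces (G1)

Topic `Literature/NumberTheory/Automorphic/Liu2021` (sequel of `Liu2021/AlbaneseBaseChangeProduct`).  PROOF FILE: theorems only — no
definition, no named fact, no global instance, sorry-free (D-0026 ±0).  [Liu2021] = Y. Liu, arXiv:2102.11518 = Camb. J. Math. 9
(2021); `l. NNNN` = lines of the author's TeX source as in `Liu2021/AppendixC/Glue.lean`.

## What is proved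

* **`Albanese.exists_of_isColimit_compat`** — the construction of `Albanese.exists_of_isColimit` (for a finite colimit cofan
  `inj_c : Y_c ⟶ X'` of geometrically irreducible `L`-schemes with Albanese data `𝒥 c : Jacobian (Y c)`: `∇X' = ∐_c Y_c × Y_c`,
  `Alb_{X'} = ⨁_c J_c`, `α = (diff_c ≫ ι_c)_c`, the biproduct projections as a limit fan) RE-RUN with ONE MORE CONJUNCT exposed:
  RE-RUN with its structure EXPOSED (head as carved by the (G)-road lead A-p18): projections `π_c` AND injections `ι_c` with
  the biproduct identities, the piece morphisms `l_c : Y_c × Y_c ⟶ ∇X'` over `inj_c × inj_c`, and `l_c ≫ α = diff_c ≫ ι_c`.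
  The existing theorem only returns `∃ a π, Nonempty (IsLimit (Fan.mk a.Alb π))`, which forgets how `α` sits against the
  pieces; the consumers of the III-0 (G)-road of the `hodgecm-mathlib` cell (the α-compatible finite-Galois Albanese fan G4,
  descent compatibility G2, `∇`-iso compatibility G3) need exactly this clause.
* `Albanese.exists_of_isColimit_compat_proj` — read through the projections, for ANY `l` over `inj_c × inj_c`:
  `l ≫ α ≫ π_c = diff_c`, `l ≫ α ≫ π_{c'} = 1` (`c' ≠ c`).
* `Albanese.exists_of_isColimit_compat_lift` — the same on test morphisms `f g : Z ⟶ Y_c`: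
  `(lift f g ≫ l) ≫ α ≫ π_c = lift f g ≫ diff_c` and `= 1` on the other factors.

Mathlib/tree API used: as in `AlbaneseBaseChangeProduct` (`nonempty_isColimit_cofanMk_of`, `IsOpenImmersion.lift`, `biproduct.*`,
`HasFiniteBiproducts.of_hasFiniteProducts`, `Fan.IsLimit.mk`) plus `biproduct.ι_π_self` / `biproduct.ι_π_ne` and `cancel_mono`.

## References

* [Liu2021] Y. Liu, arXiv:2102.11518 = Camb. J. Math. 9 (2021): §2.1 Def. 2.1 (1) (l. 1171–1174), Proposition (l. 1190–1192) with
  proof (l. 1194–1200), Def. 2.3 (l. 1202–1208).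
* [Milne1986JacobianVarieties] J. S. Milne, *Jacobian Varieties* (1986), §6 Prop. 6.4, Rem. 6.5.  [MumfordAV1970] D. Mumford,
  *Abelian Varieties* (1970), §19.  [FGAExplained2005] Kleiman, *The Picard scheme*, FGA Explained (2005), §VI (for the consumer).

## Provenance

hodgecm-mathlib cell, III-0 (G)-road piece G1 (lead A-p18), seat A-p09 g2.
-/

noncomputable section

open CategoryTheory CategoryTheory.Limits AlgebraicGeometry MonoidalCategory CartesianMonoidalCategory
open Literature.AlgebraicGeometry.Motives
open scoped MonObj

universe u

namespace Literature.NumberTheory.Automorphic.Liu2021.AppendixC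

section Construction

universe v

variable {L : Type u} [Field L]
variable {X' : SchemeOver L} {κ : Type v} [Small.{u} κ] {Y : κ → SchemeOver L} {inj : ∀ c, Y c ⟶ X'}

/-- The image of `f × g : X × Y → X'' × Y''` (fibre products over `Spec L`) is `pr₁⁻¹(f(X)) ∩ pr₂⁻¹(g(Y))` — Mathlib
`Scheme.Pullback.range_map` in the cartesian monoidal `Over (Spec L)` (local copy of the private lemma of
`AlbaneseBaseChangeProduct`). [folklore] -/
private theorem range_tensorHom_left'' {X Y X'' Y'' : SchemeOver L} (f : X ⟶ X'') (g : Y ⟶ Y'') :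
    Set.range (f ⊗ₘ g).left = (fst X'' Y'').left ⁻¹' Set.range f.left ∩
      (snd X'' Y'').left ⁻¹' Set.range g.left := by
  rw [Over.tensorHom_left]
  exact Scheme.Pullback.range_map _ _ _ _ _ _ _ _ _

/-- **[Liu2021, §2.1, proof of the Proposition] The Albanese datum of a scheme split into geometrically irreducible pieces —
construction WITH ITS STRUCTURE MAPS AND THE COMPATIBILITY OF `α` EXPOSED (G1; head as carved by the (G)-road lead).**  For ANY
field `L`, a finite colimit cofan `inj_c : Y_c ⟶ X'` (`X' ≅ ∐_c Y_c`) of geometrically irreducible `L`-schemes and Albanese data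
`𝒥 c : Motives.Jacobian (Y c)` (Milne Prop. 6.4 / Remark 6.5), there is `a : Albanese X'` (Def. 2.3) — EXACTLY the datum of
`Albanese.exists_of_isColimit` (`∇X' := ∐_c Y_c × Y_c`, `Alb_{X'} := ⨁_c J_c`, `α := (diff_c ≫ ι_c)_c`) — together with: the
projections `π_c : Alb ⟶ J_c` (a limit fan) and injections `ι_c : J_c ⟶ Alb` of the biproduct with their identities
`ι_c ≫ π_c = 𝟙`, `ι_c ≫ π_{c'} = 0` (`c ≠ c'`), `∑_c π_c ≫ ι_c = 𝟙`; the morphisms `l_c : Y_c × Y_c ⟶ ∇X'` over `inj_c × inj_c`;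
and the COMPATIBILITY `l_c ≫ α = diff_c ≫ ι_c` — Liu, l. 1194–1200: the Albanese morphism
`∇_{k'}X' → Alb_{X'} = ∏ᵢ Alb_{Xᵢ}` of the split scheme is, on `Xᵢ × Xᵢ`, the difference map of `Xᵢ` followed by the inclusion of
the `i`-th factor.  This is the clause the tree's `Nonempty`-valued statements hide and that the α-compatible finite-Galois
Albanese fan (III-0 (G)-road of the `hodgecm-mathlib` cell: `α_X(∇X)` generates `Alb_X`, [FGA VI, Thm. 3.3 (iii)]) consumes.  Ours.
[cite: Liu2021, §2.1 Def. 2.1 (1) (l. 1171–1174), Proposition (l. 1190–1192) with proof (l. 1194–1200), Def. 2.3 (l. 1202–1208)]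
[cite: Milne1986JacobianVarieties, §6 Prop. 6.4, Remark 6.5] [cite: MumfordAV1970, §19 (p. 174)] -/
theorem Albanese.exists_of_isColimit_compat [Fintype κ] (hcol : IsColimit (Cofan.mk X' inj))
    (𝒥 : ∀ c, Jacobian (Y c)) (hirr : ∀ c, GeometricallyIrreducible (Y c).hom) :
    ∃ (a : Albanese X') (π : ∀ c, a.Alb ⟶ (𝒥 c).J) (i : ∀ c, (𝒥 c).J ⟶ a.Alb) (l : ∀ c, Y c ⊗ Y c ⟶ a.nabla.N),
      Nonempty (IsLimit (Fan.mk a.Alb π)) ∧ (∀ c, i c ≫ π c = 𝟙 _) ∧ (∀ c c', c ≠ c' → i c ≫ π c' = 0) ∧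
      (∑ c, π c ≫ i c = 𝟙 a.Alb) ∧
      (∀ c, l c ≫ a.nabla.incl = inj c ⊗ₘ inj c) ∧ (∀ c, l c ≫ a.α = (𝒥 c).diff ≫ (i c).hom.hom.hom) := by
  classical
  haveI := hirr
  haveI := fun c => isOpenImmersion_left_of_isColimit hcol c
  -- finite biproducts of abelian varieties (Mumford §19), as LOCAL instances
  haveI : HasTerminal (AbelianVariety L) :=
    haveI : ∀ B : AbelianVariety L, Unique (B ⟶ AbelianVariety.trivial L) := fun B =>
      haveI : Unique (B.toGrp ⟶ (AbelianVariety.trivial L).toGrp) := Grp.uniqueHomToTrivial B.toGrp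
      InducedCategory.homEquiv.unique
    hasTerminal_of_unique (AbelianVariety.trivial L)
  haveI : HasFiniteProducts (AbelianVariety L) := hasFiniteProducts_of_has_binary_and_terminal
  haveI : HasFiniteBiproducts (AbelianVariety L) := HasFiniteBiproducts.of_hasFiniteProducts
  -- §1 the carrier `∇X'` : the open subscheme of `X' × X'` on `U = ⋃_c pr₁⁻¹ Y_c ∩ pr₂⁻¹ Y_c`
  set R : κ → Set X'.left := fun c => Set.range (inj c).left with hR
  set U : Set ↥(X' ⊗ X').left :=
    ⋃ c, ⇑(fst X' X').left ⁻¹' R c ∩ ⇑(snd X' X').left ⁻¹' R c with hU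
  have hRc : ∀ c, IsClopen (R c) := fun c => isClopen_range_left_of_isColimit hcol c
  have hUo : IsOpen U := isOpen_iUnion fun c =>
    ((hRc c).2.preimage (fst X' X').left.continuous).inter
      ((hRc c).2.preimage (snd X' X').left.continuous)
  have hUc : IsClosed U := isClosed_iUnion_of_finite fun c =>
    ((hRc c).1.preimage (fst X' X').left.continuous).inter
      ((hRc c).1.preimage (snd X' X').left.continuous)
  have hUc' : ∀ c, Set.range ⇑(inj c ⊗ₘ inj c).left = ⇑(fst X' X').left ⁻¹' R c ∩ ⇑(snd X' X').left ⁻¹' R c :=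
    fun c => range_tensorHom_left'' _ _
  obtain ⟨Uo, hUo_range⟩ : ∃ Uo : (X' ⊗ X').left.Opens, Set.range ⇑Uo.ι = U :=
    ⟨⟨U, hUo⟩, Scheme.Opens.range_ι _⟩
  let NN : SchemeOver L := Over.mk (Uo.ι ≫ (X' ⊗ X').hom)
  let incl : NN ⟶ X' ⊗ X' := Over.homMk Uo.ι rfl
  have hjo : IsOpenImmersion Uo.ι := inferInstance
  have hjc : IsClosedImmersion Uo.ι :=
    IsClosedImmersion.of_isPreimmersion Uo.ι (by rw [hUo_range]; exact hUc)
  -- the diagonal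
  have hdiag : Set.range ⇑(lift (𝟙 X') (𝟙 X')).left ⊆ Set.range ⇑Uo.ι := by
    rw [hUo_range]
    rintro _ ⟨x, rfl⟩
    obtain ⟨c, y, hy⟩ := exists_eq_left_of_isColimit hcol x
    refine Set.mem_iUnion.mpr ⟨c, ?_, ?_⟩
    · show (fst X' X').left ((lift (𝟙 X') (𝟙 X')).left x) ∈ R c
      rw [← Scheme.Hom.comp_apply, ← Over.comp_left, lift_fst]
      exact ⟨y, hy⟩
    · show (snd X' X').left ((lift (𝟙 X') (𝟙 X')).left x) ∈ R c
      rw [← Scheme.Hom.comp_apply, ← Over.comp_left, lift_snd]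
      exact ⟨y, hy⟩
  let d₀ := IsOpenImmersion.lift Uo.ι (lift (𝟙 X') (𝟙 X')).left hdiag
  have hd₀ : d₀ ≫ Uo.ι = (lift (𝟙 X') (𝟙 X')).left := IsOpenImmersion.lift_fac _ _ _
  let diag : X' ⟶ NN := Over.homMk d₀ (by
    change d₀ ≫ Uo.ι ≫ (X' ⊗ X').hom = X'.hom
    rw [← Category.assoc, hd₀]
    exact Over.w (lift (𝟙 X') (𝟙 X')))
  have hdiag_incl : diag ≫ incl = lift (𝟙 X') (𝟙 X') := Over.OverMorphism.ext hd₀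
  -- the pieces `Y_c × Y_c ⟶ ∇X'`
  have hsub : ∀ c, Set.range ⇑(inj c ⊗ₘ inj c).left ⊆ Set.range ⇑Uo.ι := fun c => by
    rw [hUo_range, hUc']
    exact Set.subset_iUnion (fun c => ⇑(fst X' X').left ⁻¹' R c ∩ ⇑(snd X' X').left ⁻¹' R c) c
  let l₀ := fun c => IsOpenImmersion.lift Uo.ι (inj c ⊗ₘ inj c).left (hsub c)
  have hl₀ : ∀ c, l₀ c ≫ Uo.ι = (inj c ⊗ₘ inj c).left := fun c => IsOpenImmersion.lift_fac _ _ _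
  let l : ∀ c, Y c ⊗ Y c ⟶ NN := fun c => Over.homMk (l₀ c) (by
    change l₀ c ≫ Uo.ι ≫ (X' ⊗ X').hom = (Y c ⊗ Y c).hom
    rw [← Category.assoc, hl₀]
    exact Over.w _)
  have hl : ∀ c, l c ≫ incl = inj c ⊗ₘ inj c := fun c => Over.OverMorphism.ext (hl₀ c)
  have hlo : ∀ c, IsOpenImmersion (l c).left := fun c => by
    have h1 : IsOpenImmersion ((l c).left ≫ Uo.ι) := by
      change IsOpenImmersion (l₀ c ≫ Uo.ι)
      rw [hl₀, Over.tensorHom_left]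
      exact MorphismProperty.pullbackMap (P := @IsOpenImmersion)
        (isOpenImmersion_left_of_isColimit hcol c) (isOpenImmersion_left_of_isColimit hcol c)
        (Over.w (inj c)).symm (Over.w (inj c)).symm
    exact @IsOpenImmersion.of_comp _ _ _ (l c).left Uo.ι hjo h1
  -- `∇X'` is the coproduct of the pieces (as schemes)
  have hm : Mono incl.left := (inferInstance : Mono Uo.ι)
  have hmono : Mono incl := @Over.mono_of_mono_left _ _ _ _ _ incl hm
  have hkey : ∀ c, lift (𝟙 (Y c)) (𝟙 (Y c)) ≫ l c = inj c ≫ diag := fun c => by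
    rw [← cancel_mono incl, Category.assoc, hl, Category.assoc, hdiag_incl]
    simp only [lift_map, comp_lift, Category.id_comp, Category.comp_id]
  have hcov : ∀ n : NN.left, ∃ (c : κ) (z : (Y c ⊗ Y c).left), (l c).left z = n := by
    intro n
    have hn : Uo.ι n ∈ U := by rw [← hUo_range]; exact ⟨n, rfl⟩
    obtain ⟨c, hc⟩ := Set.mem_iUnion.mp hn
    rw [← hUc'] at hc
    obtain ⟨z, hz⟩ := hc
    refine ⟨c, z, Uo.ι.isOpenEmbedding.injective ?_⟩
    rw [← hz, ← hl₀ c]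
    exact (Scheme.Hom.comp_apply _ _ _).symm
  have hcovU : ⨆ c, ((l c).left).opensRange = ⊤ := by
    refine top_unique fun n _ => ?_
    obtain ⟨c, z, hz⟩ := hcov n
    exact TopologicalSpace.Opens.mem_iSup.mpr ⟨c, ⟨z, hz⟩⟩
  have hdisjU : Pairwise (Function.onFun Disjoint fun c => ((l c).left).opensRange) := by
    intro c d hcd
    refine disjoint_iff_inf_le.mpr fun n ⟨⟨a, ha⟩, ⟨b, hb⟩⟩ => ?_
    have ha' : Uo.ι n ∈ Set.range ⇑(inj c ⊗ₘ inj c).left := ⟨a, by rw [← ha, ← hl₀ c, Scheme.Hom.comp_apply]; rfl⟩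
    have hb' : Uo.ι n ∈ Set.range ⇑(inj d ⊗ₘ inj d).left := ⟨b, by rw [← hb, ← hl₀ d, Scheme.Hom.comp_apply]; rfl⟩
    rw [hUc'] at ha' hb'
    exact Set.disjoint_left.mp (disjoint_range_left_of_isColimit hcol hcd) ha'.1 hb'.1
  haveI := hlo
  obtain ⟨hNcol⟩ := nonempty_isColimit_cofanMk_of (fun c => (l c).left) hcovU hdisjU
  -- §2 the abelian variety and `α`
  let A : AbelianVariety L := ⨁ fun c => (𝒥 c).J
  let αc : ∀ c, Y c ⊗ Y c ⟶ A.X := fun c => (𝒥 c).diff ≫ (biproduct.ι (fun c => (𝒥 c).J) c).hom.hom.hom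
  let α₀ : NN.left ⟶ A.X.left := Cofan.IsColimit.desc hNcol fun c => (αc c).left
  have hα₀ : ∀ c, (l c).left ≫ α₀ = (αc c).left := fun c => Cofan.IsColimit.fac hNcol _ c
  let α : NN ⟶ A.X := Over.homMk α₀ (by
    refine Cofan.IsColimit.hom_ext hNcol _ _ fun c => ?_
    change (l c).left ≫ α₀ ≫ A.X.hom = (l c).left ≫ NN.hom
    rw [← Category.assoc, hα₀, Over.w, Over.w])
  have hα : ∀ c, l c ≫ α = αc c := fun c => Over.OverMorphism.ext (hα₀ c)
  -- §3 the carrier structure `∇X'`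
  let N : Nabla X' :=
    { N := NN, incl := incl, isOpenImmersion_incl := hjo, isClosedImmersion_incl := hjc, diag := diag
      diag_incl := hdiag_incl
      minimal := fun W j hWo hWc hδ => by
        obtain ⟨δ, hδ⟩ := hδ
        haveI := hWo
        haveI := hWc
        have hsubW : Set.range ⇑Uo.ι ⊆ Set.range ⇑j.left := by
          rw [hUo_range]
          intro z hz
          obtain ⟨c, hc⟩ := Set.mem_iUnion.mp hz
          rw [← hUc'] at hc
          exact range_tensorHom_subset_range_of_diag j hδ c hc
        let f₀ := IsOpenImmersion.lift j.left Uo.ι hsubW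
        have hf₀ : f₀ ≫ j.left = Uo.ι := IsOpenImmersion.lift_fac _ _ _
        have hw : f₀ ≫ W.hom = Uo.ι ≫ (X' ⊗ X').hom := by rw [← Over.w j, ← Category.assoc, hf₀]
        exact ⟨Over.homMk f₀ hw, Over.OverMorphism.ext hf₀⟩ }
  -- §4 the universal property
  have hdiagα : diag ≫ α = 1 := by
    refine Cofan.IsColimit.hom_ext hcol _ _ fun c => ?_
    change inj c ≫ diag ≫ α = inj c ≫ 1
    rw [← Category.assoc, ← hkey, Category.assoc, hα, MonObj.comp_one]
    change lift (𝟙 (Y c)) (𝟙 (Y c)) ≫ (𝒥 c).diff ≫ _ = 1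
    rw [← Category.assoc, (𝒥 c).diag_diff, MonObj.one_comp]
  have hlf : ∀ {B : AbelianVariety L} (f : NN ⟶ B.X), diag ≫ f = 1 →
      ∀ c, lift (𝟙 (Y c)) (𝟙 (Y c)) ≫ l c ≫ f = 1 := by
    intro B f hf c
    rw [← Category.assoc, hkey, Category.assoc, hf, MonObj.comp_one]
  let descF : ∀ {B : AbelianVariety L} (f : NN ⟶ B.X), diag ≫ f = 1 → (A ⟶ B) := fun {B} f hf =>
    ∑ c, biproduct.π (fun c => (𝒥 c).J) c ≫ (𝒥 c).desc (l c ≫ f) (hlf f hf c)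
  have hιdesc : ∀ {B : AbelianVariety L} (f : NN ⟶ B.X) (hf : diag ≫ f = 1) (c : κ),
      biproduct.ι (fun c => (𝒥 c).J) c ≫ descF f hf = (𝒥 c).desc (l c ≫ f) (hlf f hf c) := by
    intro B f hf c
    simp only [descF, Preadditive.comp_sum]
    rw [Finset.sum_eq_single c]
    · rw [biproduct.ι_π_self_assoc]
    · intro d _ hdc
      rw [biproduct.ι_π_ne_assoc _ (Ne.symm hdc), zero_comp]
    · intro hc
      exact absurd (Finset.mem_univ c) hc
  have hfac : ∀ {B : AbelianVariety L} (f : NN ⟶ B.X) (hf : diag ≫ f = 1),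
      α ≫ (descF f hf).hom.hom.hom = f := by
    intro B f hf
    apply Over.OverMorphism.ext
    refine Cofan.IsColimit.hom_ext hNcol _ _ fun c => ?_
    change (l c).left ≫ (α ≫ (descF f hf).hom.hom.hom).left = (l c).left ≫ f.left
    rw [← Over.comp_left, ← Over.comp_left]
    congr 1
    rw [← Category.assoc, hα]
    change (𝒥 c).diff ≫ (biproduct.ι (fun c => (𝒥 c).J) c ≫ descF f hf).hom.hom.hom = l c ≫ f
    rw [hιdesc f hf c, (𝒥 c).fac]
  have huniq : ∀ {B : AbelianVariety L} (f : NN ⟶ B.X) (hf : diag ≫ f = 1) (ψ : A ⟶ B),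
      α ≫ ψ.hom.hom.hom = f → ψ = descF f hf := by
    intro B f hf ψ hψ
    refine biproduct.hom_ext' _ _ fun c => ?_
    rw [hιdesc f hf c]
    refine (𝒥 c).uniq _ _ _ ?_
    change ((𝒥 c).diff ≫ (biproduct.ι (fun c => (𝒥 c).J) c).hom.hom.hom) ≫ ψ.hom.hom.hom = l c ≫ f
    rw [← hψ, ← Category.assoc, hα]
  -- §5 the biproduct is a product
  have hlim : IsLimit (Fan.mk A fun c => biproduct.π (fun c => (𝒥 c).J) c) :=
    Fan.IsLimit.mk _ (fun t => biproduct.lift fun c => t.proj c)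
      (fun t c => biproduct.lift_π _ _)
      (fun t m hm => biproduct.hom_ext _ _ fun c => by rw [biproduct.lift_π]; exact hm c)
  -- §6 (G1) the biproduct identities and the compatibility of `α` with the pieces, EXPOSED
  have htotal : ∑ c, biproduct.π (fun c => (𝒥 c).J) c ≫ biproduct.ι (fun c => (𝒥 c).J) c = 𝟙 A := by
    refine biproduct.hom_ext _ _ fun c' => ?_
    rw [Preadditive.sum_comp, Category.id_comp, Finset.sum_eq_single c']
    · rw [Category.assoc, biproduct.ι_π_self, Category.comp_id]
    · intro c _ hc
      rw [Category.assoc, biproduct.ι_π_ne _ hc, comp_zero]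
    · intro h
      exact absurd (Finset.mem_univ _) h
  exact ⟨{ nabla := N, Alb := A, α := α, diag_α := hdiagα, desc := descF, fac := hfac, uniq := huniq },
    fun c => biproduct.π (fun c => (𝒥 c).J) c, fun c => biproduct.ι (fun c => (𝒥 c).J) c, l, ⟨hlim⟩,
    fun c => biproduct.ι_π_self _ c, fun c c' h => biproduct.ι_π_ne _ h, htotal, hl, hα⟩


/-- The morphism `(0 : A ⟶ B)` of abelian varieties is the unit section on underlying schemes, and `(ι_c ≫ π_{c'})` read on
schemes: **the projections of `α` on the pieces.**  In the datum of `Albanese.exists_of_isColimit_compat`, for every piece `c` and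
THE morphism `l : Y_c × Y_c ⟶ ∇X'` over `inj_c × inj_c` (any such; `∇X' ↪ X' × X'` is a monomorphism): `l ≫ α ≫ π_c = diff_c` and
`l ≫ α ≫ π_{c'} = 1` for `c' ≠ c`.  Ours. [cite: Liu2021, §2.1 Proposition, proof (l. 1194–1200)] -/
theorem Albanese.exists_of_isColimit_compat_proj [Fintype κ] (hcol : IsColimit (Cofan.mk X' inj))
    (𝒥 : ∀ c, Jacobian (Y c)) (hirr : ∀ c, GeometricallyIrreducible (Y c).hom) :
    ∃ (a : Albanese X') (π : ∀ c, a.Alb ⟶ (𝒥 c).J), Nonempty (IsLimit (Fan.mk a.Alb π)) ∧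
      ∀ (c : κ) (l : Y c ⊗ Y c ⟶ a.nabla.N), l ≫ a.nabla.incl = inj c ⊗ₘ inj c →
        l ≫ a.α ≫ (π c).hom.hom.hom = (𝒥 c).diff ∧
          ∀ c', c' ≠ c → l ≫ a.α ≫ (π c').hom.hom.hom = 1 := by
  obtain ⟨a, π, i, l, hlim, hiπ, hiπ', -, hl, hα⟩ := Albanese.exists_of_isColimit_compat hcol 𝒥 hirr
  haveI := a.nabla.isOpenImmersion_incl
  have hmono : Mono a.nabla.incl := Over.mono_of_mono_left _
  refine ⟨a, π, hlim, fun c l' hl' => ?_⟩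
  have hll : l' = l c := by rw [← cancel_mono a.nabla.incl, hl', hl c]
  subst hll
  have key : ∀ c', l c ≫ a.α ≫ (π c').hom.hom.hom =
      (𝒥 c).diff ≫ ((i c ≫ π c').hom.hom.hom : (𝒥 c).J.X ⟶ (𝒥 c').J.X) := fun c' => by
    rw [← Category.assoc, hα c, Category.assoc]
    rfl
  refine ⟨?_, fun c' hc' => ?_⟩
  · rw [key, hiπ c]
    exact Category.comp_id _
  · rw [key, hiπ' c c' (Ne.symm hc')]
    exact MonObj.comp_one _

/-- **(G1) on test morphisms.**  In the same datum, for `f g : Z ⟶ Y_c` the morphism «`(inj_c f, inj_c g)` into `∇X'`» is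
`lift f g ≫ l`, and `(lift f g ≫ l) ≫ α ≫ π_c = lift f g ≫ diff_c` (`= [f − g]` in `J_c(Z)`), `(lift f g ≫ l) ≫ α ≫ π_{c'} = 1` for
`c' ≠ c`.  Ours. [cite: Liu2021, §2.1 Proposition, proof (l. 1194–1200)] -/
theorem Albanese.exists_of_isColimit_compat_lift [Fintype κ] (hcol : IsColimit (Cofan.mk X' inj))
    (𝒥 : ∀ c, Jacobian (Y c)) (hirr : ∀ c, GeometricallyIrreducible (Y c).hom) :
    ∃ (a : Albanese X') (π : ∀ c, a.Alb ⟶ (𝒥 c).J), Nonempty (IsLimit (Fan.mk a.Alb π)) ∧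
      ∀ (c : κ) (l : Y c ⊗ Y c ⟶ a.nabla.N), l ≫ a.nabla.incl = inj c ⊗ₘ inj c →
        ∀ {Z : SchemeOver L} (f g : Z ⟶ Y c),
          (lift f g ≫ l) ≫ a.α ≫ (π c).hom.hom.hom = lift f g ≫ (𝒥 c).diff ∧
            ∀ c', c' ≠ c → (lift f g ≫ l) ≫ a.α ≫ (π c').hom.hom.hom = 1 := by
  obtain ⟨a, π, hlim, hcompat⟩ := Albanese.exists_of_isColimit_compat_proj hcol 𝒥 hirr
  refine ⟨a, π, hlim, fun c l hl Z f g => ⟨?_, fun c' hc' => ?_⟩⟩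
  · rw [Category.assoc, (hcompat c l hl).1]
  · rw [Category.assoc, (hcompat c l hl).2 c' hc', MonObj.comp_one]

end Construction

end Literature.NumberTheory.Automorphic.Liu2021.AppendixC

end
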